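import Summits.Langlands.Langlands.Theses.ExteriorSquareAscent
import Literature.NumberTheory.Automorphic.PairLFunctionPolesRepData
import Literature.NumberTheory.Automorphic.AsgariRaghuramExteriorSquareCuspidalProofs
import Literature.NumberTheory.Automorphic.KimExteriorSquareGL4
import Literature.NumberTheory.Automorphic.BockleHuiIrreducibleGL3AnalyticProofs
import Literature.NumberTheory.GaloisRepresentations.WeakAbelianDirectSummand

/-!
# Skeleton (line `Sketch`) for crux stmt-Langlands-18054
`Summit.Langlands.Langlands.Theses.ExteriorSquareAscent.ReducibleInducesSquare`

Route `route-Langlands-ExteriorSquareAscent` (crux #3). The crux: `K` ANY number field, `π` cuspidal on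
`GL₄(𝔸_K)` with a Hecke field, NOT essentially self-dual and NOT quadratically self-twisted at Satake level;
`ρ : Γ_K → GL₄(ℚ̄_ℓ)` semisimple, Satake–Frobenius compatible with `(π, ι)` a.e., REDUCIBLE ⟹ a quadratic
`L/K` and a cuspidal `P` on `GL₃(𝔸_L)` inducing the exterior-square Satake data of `π`.

## The line (cards `rs-collapse`, `slope-flip`; the (2,2) pole count of `dual-pair-rankin-selberg-syzygy`)

Both reducible shapes are CONTRADICTORY, so the conclusion is reached ex falso:

* a Γ-stable LINE (3,1): Böckle–Hui Thm 1.1 (PROVED in the tree) turns the line character into a Hecke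
  character `μ` with `μ(ϖ_v) ∈ t_{π,v}` a.e. (`stub_lineHecke`); the eight-term identity
  `∧²t·m⁻² ⊔ {ω m⁻⁴} ⊔ {1} = t⁻¹·ω m⁻³ ⊔ t·m⁻¹` (`m = μ(ϖ_v)`, `ω = det t`) of partial Euler products,
  `L(Π × μ⁻²) L(ω μ⁻⁴) ζ_K = L(π^∨ × ω μ⁻³) L(π × μ⁻¹)` with `Π` the CUSPIDAL exterior square, is impossible:
  pole on the left, none on the right — on the unitary axis by Jacquet–Shalika (2.2), off it by absolute
  convergence after the contragredient flip (`stub_noLineAnalytic`, the n = 4 twin of the tree's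
  `norm_prod_satake_eq_norm_cube_of_JS` / `prod_satake_eq_cube_of_JS`);
* two complementary Γ-stable PLANES (2,2): block form `ρ ~ diag(S, T)` (`stub_planesBlocks`); the character
  `det S` weakly divides the E-rational 6-dimensional `det S ⊕ det T ⊕ (S ⊗ T)` (`stub_planesAmbient`: its
  Frobenius polynomial is the sextic `∧²`-resolvent of that of `ρ`), so Böckle–Hui gives a Hecke character `χ`
  splitting `t_{π,v} = S_v ⊔ T_v`, `|S_v| = 2`, `∏ S_v = χ(ϖ_v)` a.e. (`stub_planesHecke`); the 46-term
  dual-pair identity `λ·V = λ·W` of partial Euler products (`λ = ω χ⁻²`),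
  `L(π×π^∨⊗λ) L(π×π^∨⊗λ²) L(Π⊗χ⁻¹λ)² ζ_K L(λ³) = L(π×(π⊗χ⁻¹λ)) L(π^∨×(π^∨⊗χλ²)) L(Π⊗χ⁻¹) L(Π⊗χ⁻¹λ²) L(λ) L(λ²)`,
  has pole order ≥ `1 + [λ=1] + [λ²=1] + [λ³=1]` on the left and ≤ `[λ=1] + [λ²=1]` on the right because `π`
  is NOT essentially self-dual (Jacquet–Shalika (2.2)/(2.3); off the unitary axis by the slope flip `S ↔ T`)
  (`stub_noPlanesAnalytic`);
* the cuspidal `GL₆` datum `Π` with `t_Π = ∧² t_π` comes from Asgari–Raghuram (i)⇒(iii) in its contrapositive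
  Satake rendering, fed by the crux's two `¬` hypotheses — the quadratic-field form of "self-twisted" via
  `χ⁴ = 1` and CFT for quadratic characters, PROVED in the tree (`stub_wedgeTwoCuspidal`).

Named facts entering as explicit hypotheses of the composition (the result is CONDITIONAL on them, nothing
else): `JacquetShalika1981_partialPairL_boundary_repData` ((2.2)), `JacquetShalika1981_partialPairL_pole_repData`
((2.3)), `AsgariRaghuram2007_selfDual_or_selfTwist_of_wedgeTwo_not_cuspidal`.

Proved here (not stubs): `E`-rationality of a compatible `ρ` from the Hecke field (`isRationalOver_of_heckeField`),
the `3+1 / 2+2` case split (`twoPlusTwo_of_not_isIrreducible`, from line `birth`), and the composition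
`ReducibleInducesSquare_of`, concluding the route decl BY NAME.
-/

set_option linter.dupNamespace false
set_option linter.unusedVariables false

noncomputable section

namespace Summit.Langlands.Langlands.Cruxes.ReducibleInducesSquare.Sketch

open Summit.Langlands.Langlands.Theses.ExteriorSquareAscent
open Literature.NumberTheory.GaloisRepresentations Literature.NumberTheory.Automorphic
open NumberField IsDedekindDomain Filter Polynomial
open scoped Classical MatrixGroups

/-! ## 1. The seven stubs -/

/-- **STUB A — the character of a stable line is a Hecke character among the Satake eigenvalues (any `K`).**
For `π` cuspidal on `GL₄(𝔸_K)`, `ρ : Γ_K → GL₄(ℚ̄_ℓ)` semisimple, a.e. Satake–Frobenius compatible with `(π, ι)`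
and `E`-rational for some number field `E`, and a `Γ_K`-stable LINE `W`: there is a Hecke character `μ` of `K`
with `μ(ϖ_v) ∈ t_{π,v}` for almost all `v`. Route: stable line ⇒ character `τ` on it
(`exists_stableLine_of_finrank_eq_one`, `FramedRep.exists_rankOne_of_stableLine`), `τ` weakly divides `ρ`,
Böckle–Hui Thm 1.1 (`exists_heckeCharacter_of_weaklyDivides_holds`) gives algebraic `χ` with
`τ(Frob_v) = ι⁻¹(χ(ϖ_v))⁻¹`; compatibility reads `τ(Frob_v) = ι⁻¹((q_v^{3/2} a)⁻¹)`, `a ∈ t_{π,v}`, so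
`μ := χ · ‖·‖^{3/2}` (`exists_heckeCharacter_ideleNorm_cpow`) works.
[cite: BockleHui2025, Thm. 1.1 and §3.2.1] [cite: Shavali2026, Prop. 4.1] -/
theorem stub_lineHecke :
    ∀ (K : Type) [Field K] [NumberField K]
      (hcpt : Literature.NumberTheory.Automorphic.isCompact_glFiniteIntegralLevel 4 K)
      (π : Literature.NumberTheory.Automorphic.CuspidalAutomorphicRepData 4 K hcpt)
      (ℓ : ℕ) [Fact ℓ.Prime] (ι : PadicAlgCl ℓ ≃+* ℂ)
      (ρ : Literature.NumberTheory.GaloisRepresentations.FramedGaloisRep K (PadicAlgCl ℓ) 4),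
      ρ.toGaloisRep.IsSemisimple →
      (∀ᶠ v : IsDedekindDomain.HeightOneSpectrum (NumberField.RingOfIntegers K) in Filter.cofinite,
        ∃ α : Multiset ℂ, π.1.HasSatakeParamAt v α ∧ ρ.IsUnramifiedAt v ∧
          ρ.HasFrobCharpolyAt v
            (Literature.NumberTheory.Automorphic.arithFrobPolyOfSatake ι v.residueCard 4 α)) →
      (∃ (E : Type) (_ : Field E) (_ : NumberField E) (e : E →+* PadicAlgCl ℓ), ρ.IsRationalOver e) →
      ∀ W : Subrepresentation ρ.toGaloisRep.toRepresentation,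
        Module.finrank (PadicAlgCl ℓ) W.toSubmodule = 1 →
        ∃ μ : Literature.NumberTheory.GaloisRepresentations.HeckeCharacter K,
          ∀ᶠ v : IsDedekindDomain.HeightOneSpectrum (NumberField.RingOfIntegers K) in Filter.cofinite,
            ∀ α : Multiset ℂ, π.1.HasSatakeParamAt v α → μ.valueAtUniformizer v ∈ α := by
  sorry

/-- **STUB B — two complementary stable planes put `ρ` in block form (linear algebra).** If `W₁ ⊕ W₂ = ℚ̄_ℓ⁴`
are complementary `Γ_K`-stable planes of `ρ : Γ_K → GL₄(ℚ̄_ℓ)`, there are continuous `S, T : Γ_K → GL₂(ℚ̄_ℓ)`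
(the actions on `W₁`, `W₂` in chosen bases) with `charpoly ρ(g) = charpoly S(g) · charpoly T(g)` for every `g`
and `S(g) = T(g) = 1` whenever `ρ(g) = 1`. [folklore] -/
theorem stub_planesBlocks :
    ∀ (K : Type) [Field K] [NumberField K] (ℓ : ℕ) [Fact ℓ.Prime]
      (ρ : Literature.NumberTheory.GaloisRepresentations.FramedGaloisRep K (PadicAlgCl ℓ) 4)
      (W₁ W₂ : Subrepresentation ρ.toGaloisRep.toRepresentation), IsCompl W₁ W₂ →
      Module.finrank (PadicAlgCl ℓ) W₁.toSubmodule = 2 →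
      Module.finrank (PadicAlgCl ℓ) W₂.toSubmodule = 2 →
      ∃ S T : Literature.NumberTheory.GaloisRepresentations.FramedGaloisRep K (PadicAlgCl ℓ) 2,
        (∀ g : Field.absoluteGaloisGroup K,
          Literature.NumberTheory.GaloisRepresentations.FramedRep.charpoly ρ g =
            Literature.NumberTheory.GaloisRepresentations.FramedRep.charpoly S g *
              Literature.NumberTheory.GaloisRepresentations.FramedRep.charpoly T g) ∧
        (∀ g : Field.absoluteGaloisGroup K, ρ g = 1 → S g = 1 ∧ T g = 1) := by
  sorry

/-- **STUB C — the ambient `E`-rational representation for `det S` (the `∧²` of the block form).** For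
`ρ : Γ_K → GL₄(ℚ̄_ℓ)` unramified a.e. in block form `charpoly ρ = charpoly S · charpoly T` (`S, T` of rank 2,
trivial where `ρ` is): there are a character `ψ` with `ψ(g) = det S(g)` and a rank-6 `ρ'` (block diagonal
`det S ⊕ det T ⊕ (S ⊗ T)`, Kronecker product) such that `ψ` weakly divides `ρ'` and `ρ'` is `E`-rational
whenever `ρ` is: `charpoly ρ'(g) = R(charpoly ρ(g))` for the sextic resolvent
`R(X⁴ - e₁X³ + e₂X² - e₃X + e₄) = X⁶ - e₂X⁵ + (e₁e₃ - e₄)X⁴ - (e₃² + e₁²e₄ - 2e₂e₄)X³ + e₄(e₁e₃ - e₄)X² - e₂e₄²X + e₄³`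
(= `(X - det S)(X - det T)·charpoly(S ⊗ T)`, `charpoly(S ⊗ T) = X⁴ - ac X³ + (a²d + c²b - 2bd) X² - abcd X + b²d²`
for `charpoly S = X² - aX + b`, `charpoly T = X² - cX + d`; both identities checked symbolically).
[cite: BockleHui2025, §1.1 and §2.1] -/
theorem stub_planesAmbient :
    ∀ (K : Type) [Field K] [NumberField K] (ℓ : ℕ) [Fact ℓ.Prime]
      (ρ : Literature.NumberTheory.GaloisRepresentations.FramedGaloisRep K (PadicAlgCl ℓ) 4)
      (S T : Literature.NumberTheory.GaloisRepresentations.FramedGaloisRep K (PadicAlgCl ℓ) 2),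
      (∀ g : Field.absoluteGaloisGroup K,
        Literature.NumberTheory.GaloisRepresentations.FramedRep.charpoly ρ g =
          Literature.NumberTheory.GaloisRepresentations.FramedRep.charpoly S g *
            Literature.NumberTheory.GaloisRepresentations.FramedRep.charpoly T g) →
      (∀ g : Field.absoluteGaloisGroup K, ρ g = 1 → S g = 1 ∧ T g = 1) →
      (∀ᶠ v : IsDedekindDomain.HeightOneSpectrum (NumberField.RingOfIntegers K) in Filter.cofinite,
        ρ.IsUnramifiedAt v) →
      ∃ (ψ : Literature.NumberTheory.GaloisRepresentations.FramedGaloisRep K (PadicAlgCl ℓ) 1)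
        (ρ' : Literature.NumberTheory.GaloisRepresentations.FramedGaloisRep K (PadicAlgCl ℓ) 6),
        (∀ g : Field.absoluteGaloisGroup K,
          ((ψ g : Matrix.GeneralLinearGroup (Fin 1) (PadicAlgCl ℓ)) :
              Matrix (Fin 1) (Fin 1) (PadicAlgCl ℓ)) 0 0 =
            ((S g : Matrix.GeneralLinearGroup (Fin 2) (PadicAlgCl ℓ)) :
              Matrix (Fin 2) (Fin 2) (PadicAlgCl ℓ)).det) ∧
        ψ.WeaklyDivides ρ' ∧
        ∀ (E : Type) [Field E] [NumberField E] (e : E →+* PadicAlgCl ℓ),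
          ρ.IsRationalOver e → ρ'.IsRationalOver e := by
  sorry

/-- **STUB D — the pair-product Hecke character of the (2,2) shape.** For `π` cuspidal on `GL₄(𝔸_K)`,
`ρ : Γ_K → GL₄(ℚ̄_ℓ)` a.e. compatible with `(π, ι)` and `E`-rational, a rank-2 `S` with
`charpoly S(g) ∣ charpoly ρ(g)`, and the data of STUB C (`ψ = det S` weakly dividing an `E`-rational `ρ'`):
Böckle–Hui Thm 1.1 (PROVED in the tree; replayed WITHOUT its idle semisimplicity hypothesis from
`exists_heckeCharacter_of_weaklyDivides_of_thm22` + `LogLinear.pow_isLocallyAlgebraic_of_frobenius_isAlgebraic`)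
makes `ψ` an algebraic Hecke character `χ₁`, `ψ(Frob_v) = ι⁻¹(χ₁(ϖ_v))⁻¹`; as `det S(Frob_v)` is the product of
two roots `ι⁻¹((q_v^{3/2}a)⁻¹)`, `a ∈ β ≤ t_{π,v}`, `|β| = 2`, the character `χ := χ₁‖·‖³` splits the Satake
multiset: `t_{π,v} = β + γ`, `∏ β = χ(ϖ_v)`, a.e. [cite: BockleHui2025, Thm. 1.1] [cite: Shavali2026, Prop. 4.2] -/
theorem stub_planesHecke :
    ∀ (K : Type) [Field K] [NumberField K]
      (hcpt : Literature.NumberTheory.Automorphic.isCompact_glFiniteIntegralLevel 4 K)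
      (π : Literature.NumberTheory.Automorphic.CuspidalAutomorphicRepData 4 K hcpt)
      (ℓ : ℕ) [Fact ℓ.Prime] (ι : PadicAlgCl ℓ ≃+* ℂ)
      (ρ : Literature.NumberTheory.GaloisRepresentations.FramedGaloisRep K (PadicAlgCl ℓ) 4),
      (∀ᶠ v : IsDedekindDomain.HeightOneSpectrum (NumberField.RingOfIntegers K) in Filter.cofinite,
        ∃ α : Multiset ℂ, π.1.HasSatakeParamAt v α ∧ ρ.IsUnramifiedAt v ∧
          ρ.HasFrobCharpolyAt v
            (Literature.NumberTheory.Automorphic.arithFrobPolyOfSatake ι v.residueCard 4 α)) →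
      (∃ (E : Type) (_ : Field E) (_ : NumberField E) (e : E →+* PadicAlgCl ℓ), ρ.IsRationalOver e) →
      ∀ (S : Literature.NumberTheory.GaloisRepresentations.FramedGaloisRep K (PadicAlgCl ℓ) 2),
        (∀ g : Field.absoluteGaloisGroup K,
          Literature.NumberTheory.GaloisRepresentations.FramedRep.charpoly S g ∣
            Literature.NumberTheory.GaloisRepresentations.FramedRep.charpoly ρ g) →
        ∀ (ψ : Literature.NumberTheory.GaloisRepresentations.FramedGaloisRep K (PadicAlgCl ℓ) 1)
          (ρ' : Literature.NumberTheory.GaloisRepresentations.FramedGaloisRep K (PadicAlgCl ℓ) 6),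
          (∀ g : Field.absoluteGaloisGroup K,
            ((ψ g : Matrix.GeneralLinearGroup (Fin 1) (PadicAlgCl ℓ)) :
                Matrix (Fin 1) (Fin 1) (PadicAlgCl ℓ)) 0 0 =
              ((S g : Matrix.GeneralLinearGroup (Fin 2) (PadicAlgCl ℓ)) :
                Matrix (Fin 2) (Fin 2) (PadicAlgCl ℓ)).det) →
          ψ.WeaklyDivides ρ' →
          (∀ (E : Type) [Field E] [NumberField E] (e : E →+* PadicAlgCl ℓ),
            ρ.IsRationalOver e → ρ'.IsRationalOver e) →
          ∃ χ : Literature.NumberTheory.GaloisRepresentations.HeckeCharacter K,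
            ∀ᶠ v : IsDedekindDomain.HeightOneSpectrum (NumberField.RingOfIntegers K) in Filter.cofinite,
              ∀ α : Multiset ℂ, π.1.HasSatakeParamAt v α →
                ∃ β γ : Multiset ℂ, β + γ = α ∧ Multiset.card β = 2 ∧
                  β.prod = χ.valueAtUniformizer v := by
  sorry

/-- **STUB E — the cuspidal exterior square (Asgari–Raghuram, contrapositive Satake form, from the crux's two
`¬` hypotheses).** Granting `AsgariRaghuram2007_selfDual_or_selfTwist_of_wedgeTwo_not_cuspidal`: if `π`
(cuspidal on `GL₄(𝔸_K)`) is NOT essentially self-dual at Satake level by any `GL(1)` datum and NOT self-twisted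
by the quadratic sign of any quadratic `L'/K`, then some CUSPIDAL datum `Π` on `GL₆(𝔸_K)` has Satake parameter
`∧² t_{π,v}` a.e. Bridges: a Hecke character is a `GL(1)` datum
(`exists_cuspidal_glOne_hasSatakeParamAt_valueAtUniformizer`); a Satake self-twist character `ξ ≠ 1` on `GL₄`
has `ξ⁴ = 1` (`det`), so `ξ` or `ξ²` is quadratic `≠ 1` (`HeckeCharacter.eq_one_of_eventually_valueAtUniformizer_eq_one`),
hence the CFT character of a quadratic `L'/K` (`HeckeCharacter.exists_quadratic_isClassFieldCharacter`, PROVED)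
with value the quadratic sign a.e. (`valueAtUniformizer_eq_quadraticSign_of_orderOf`).
[cite: AsgariRaghuram2007, Theorem 1.1 (i)⇒(iii)] -/
theorem stub_wedgeTwoCuspidal :
    ∀ (K : Type) [Field K] [NumberField K]
      (h1 : Literature.NumberTheory.Automorphic.isCompact_glFiniteIntegralLevel 1 K)
      (hcpt : Literature.NumberTheory.Automorphic.isCompact_glFiniteIntegralLevel 4 K)
      (h6 : Literature.NumberTheory.Automorphic.isCompact_glFiniteIntegralLevel 6 K)
      (π : Literature.NumberTheory.Automorphic.CuspidalAutomorphicRepData 4 K hcpt),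
      Literature.NumberTheory.Automorphic.AsgariRaghuram2007_selfDual_or_selfTwist_of_wedgeTwo_not_cuspidal →
      ¬ (∃ η : Literature.NumberTheory.Automorphic.CuspidalAutomorphicRepData 1 K h1,
          ∀ᶠ v in Filter.cofinite, ∀ α : Multiset ℂ, π.1.HasSatakeParamAt v α →
            ∃ e : ℂ, η.1.HasSatakeParamAt v {e} ∧ α.map (fun a => a⁻¹) = α.map (fun a => e * a)) →
      ¬ (∃ (L' : Type) (_ : Field L') (_ : NumberField L') (_ : Algebra K L'), Module.finrank K L' = 2 ∧
          ∀ᶠ v : IsDedekindDomain.HeightOneSpectrum (NumberField.RingOfIntegers K) in Filter.cofinite,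
            ∀ α : Multiset ℂ, π.1.HasSatakeParamAt v α →
              α.map (fun a => (if ∃ w : IsDedekindDomain.HeightOneSpectrum (NumberField.RingOfIntegers L'),
                w.asIdeal.under (NumberField.RingOfIntegers K) = v.asIdeal ∧
                  w.asIdeal.inertiaDeg (NumberField.RingOfIntegers K) = 1 then (1 : ℂ) else -1) * a) = α) →
      ∃ P6 : Literature.NumberTheory.Automorphic.CuspidalAutomorphicRepData 6 K h6,
        ∀ᶠ v : IsDedekindDomain.HeightOneSpectrum (NumberField.RingOfIntegers K) in Filter.cofinite,
          ∀ α : Multiset ℂ, π.1.HasSatakeParamAt v α →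
            P6.1.HasSatakeParamAt v (Literature.NumberTheory.Automorphic.wedgeTwoParams α) := by
  sorry

/-- **STUB F — no Hecke character among the Satake eigenvalues of a cuspidal `π` on `GL₄` with cuspidal
exterior square (the (3,1) case is empty; any `K`, no weight hypothesis).** Granting Jacquet–Shalika (2.2) for
Borel–Jacquet data: for `π` cuspidal on `GL₄(𝔸_K)`, `Π` cuspidal on `GL₆(𝔸_K)` with `t_Π = ∧² t_π` a.e., and a
Hecke character `μ`, it is NOT the case that `μ(ϖ_v) ∈ t_{π,v}` a.e. Proof: unitarise (`centralCharacter_satake_of_cuspidal`,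
`exists_heckeCharacter_ideleNorm_cpow`, twists `exists_twist_hecke_hasSatakeParamAt`); the identity of Euler
factors `P(∧²t, m⁻²) P(ω m⁻⁴, 1) P(1, 1) = P(t⁻¹, ω m⁻³) P(t, m⁻¹)` gives
`L(Π × μ⁻²) L(ω μ⁻⁴) ζ_K^S = L(π^∨ × ω μ⁻³) L(π × μ⁻¹)`; if `|m| = 1`: left side has a pole (Hecke's pole,
(2.2) non-vanishing for `GL₆ × GL₁` and `GL₁ × GL₁`, or a second pole), right side is finite ((2.2), `4 ≠ 1`,
contragredient datum `exists_contragredient_satake_holds`); if `|m| = q^{-d}`, `d ≠ 0`: all shifts have one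
sign, flip to the dual data if needed, and absolute convergence / interior non-vanishing
(`continuousAt_and_ne_zero_partialPairL_repData`) against the pole of `ζ_K^S` — as in the tree's
`norm_prod_satake_eq_norm_cube_of_JS` for `n = 3`. [cite: Shavali2026, Prop. 4.1]
[cite: ArthurClozelAMS120, Ch. 3 §2 (2.1)–(2.3)] [cite: BockleHui2025, §3.2.1] -/
theorem stub_noLineAnalytic :
    ∀ (K : Type) [Field K] [NumberField K]
      (hcpt : Literature.NumberTheory.Automorphic.isCompact_glFiniteIntegralLevel 4 K)
      (h6 : Literature.NumberTheory.Automorphic.isCompact_glFiniteIntegralLevel 6 K)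
      (π : Literature.NumberTheory.Automorphic.CuspidalAutomorphicRepData 4 K hcpt)
      (P6 : Literature.NumberTheory.Automorphic.CuspidalAutomorphicRepData 6 K h6),
      Literature.NumberTheory.Automorphic.JacquetShalika1981_partialPairL_boundary_repData →
      (∀ᶠ v : IsDedekindDomain.HeightOneSpectrum (NumberField.RingOfIntegers K) in Filter.cofinite,
        ∀ α : Multiset ℂ, π.1.HasSatakeParamAt v α →
          P6.1.HasSatakeParamAt v (Literature.NumberTheory.Automorphic.wedgeTwoParams α)) →
      ∀ μ : Literature.NumberTheory.GaloisRepresentations.HeckeCharacter K,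
        ¬ (∀ᶠ v : IsDedekindDomain.HeightOneSpectrum (NumberField.RingOfIntegers K) in Filter.cofinite,
            ∀ α : Multiset ℂ, π.1.HasSatakeParamAt v α → μ.valueAtUniformizer v ∈ α) := by
  sorry

/-- **STUB G — no pair-product Hecke character for a cuspidal, NOT essentially self-dual `π` on `GL₄` with
cuspidal exterior square (the (2,2) case is empty; any `K`, no weight hypothesis).** Granting Jacquet–Shalika
(2.2) and (2.3) for Borel–Jacquet data: for `π` cuspidal on `GL₄(𝔸_K)` NOT essentially self-dual at Satake
level (no Hecke `e` with `t⁻¹ = e(ϖ_v) t` a.e.), `Π` cuspidal on `GL₆(𝔸_K)` with `t_Π = ∧² t_π` a.e., and a Hecke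
character `χ`, it is NOT the case that a.e. `t_{π,v} = β_v + γ_v` with `|β_v| = 2`, `∏ β_v = χ(ϖ_v)`. Proof: with
`ω` the central character at Satake level, `η = ω χ⁻¹`, `λ = η χ⁻¹`, the 46-term multiset identity
`λ·V = λ·W` (card `dual-pair-rankin-selberg-syzygy`; it only uses `β⁻¹ = (∏β)⁻¹·β` for `|β| = 2`) gives
`L(π×π^∨⊗λ) L(π×π^∨⊗λ²) L(Π⊗χ⁻¹λ)² ζ_K^S L(λ³) = L(π×(π⊗χ⁻¹λ)) L(π^∨×(π^∨⊗χλ²)) L(Π⊗χ⁻¹) L(Π⊗χ⁻¹λ²) L(λ) L(λ²)`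
off a finite `S`; after unitarising, if `|χ(ϖ)| ≡ 1`: pole order ≥ `1 + [λ=1] + [λ²=1] + [λ³=1]` on the left
((2.3) for `π × π^∨`, (2.2) non-vanishing elsewhere, Hecke), ≤ `[λ=1] + [λ²=1]` on the right ((2.2): the
`GL₄ × GL₄` pairs are off `X` because `π` is not essentially self-dual; `GL₆ × GL₁` finite); otherwise relabel
`β ↔ γ` so that every shift is `≥ 0` and compare absolute convergence with the pole of `ζ_K^S`.
[cite: Shavali2026, Prop. 4.2] [cite: ArthurClozelAMS120, Ch. 3 §2 (2.1)–(2.3)]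
[cite: JacquetShalikaAJM1981II, Prop. 3.6 and Thm. 4.4] -/
theorem stub_noPlanesAnalytic :
    ∀ (K : Type) [Field K] [NumberField K]
      (hcpt : Literature.NumberTheory.Automorphic.isCompact_glFiniteIntegralLevel 4 K)
      (h6 : Literature.NumberTheory.Automorphic.isCompact_glFiniteIntegralLevel 6 K)
      (π : Literature.NumberTheory.Automorphic.CuspidalAutomorphicRepData 4 K hcpt)
      (P6 : Literature.NumberTheory.Automorphic.CuspidalAutomorphicRepData 6 K h6),
      Literature.NumberTheory.Automorphic.JacquetShalika1981_partialPairL_boundary_repData →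
      Literature.NumberTheory.Automorphic.JacquetShalika1981_partialPairL_pole_repData →
      (∀ᶠ v : IsDedekindDomain.HeightOneSpectrum (NumberField.RingOfIntegers K) in Filter.cofinite,
        ∀ α : Multiset ℂ, π.1.HasSatakeParamAt v α →
          P6.1.HasSatakeParamAt v (Literature.NumberTheory.Automorphic.wedgeTwoParams α)) →
      (¬ ∃ e : Literature.NumberTheory.GaloisRepresentations.HeckeCharacter K,
          ∀ᶠ v : IsDedekindDomain.HeightOneSpectrum (NumberField.RingOfIntegers K) in Filter.cofinite,
            ∀ α : Multiset ℂ, π.1.HasSatakeParamAt v α →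
              α.map (fun a => a⁻¹) = α.map (fun a => e.valueAtUniformizer v * a)) →
      ∀ χ : Literature.NumberTheory.GaloisRepresentations.HeckeCharacter K,
        ¬ (∀ᶠ v : IsDedekindDomain.HeightOneSpectrum (NumberField.RingOfIntegers K) in Filter.cofinite,
            ∀ α : Multiset ℂ, π.1.HasSatakeParamAt v α →
              ∃ β γ : Multiset ℂ, β + γ = α ∧ Multiset.card β = 2 ∧
                β.prod = χ.valueAtUniformizer v) := by
  sorry

/-! ### Helper stubs of the lead's `stub_noPlanesAnalytic` (registered so that they can be proved in
parallel and landed `--supports`; they enter the composition only as idle hypotheses) -/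

/-- **HELPER-STUB H1 — the analytic package of `L^S(s, π₁ × π₂)` on `GL_n × GL_n`** (Jacquet–Shalika
(2.1)–(2.3) for Borel–Jacquet data, plus interior continuity/non-vanishing): for cuspidal data `P₁, P₂` on
`GL_n(𝔸_F)` with unitary Satake families `β₁, β₂` a.e., there is a finite `S₀` such that off every finite
`S ⊇ S₀` the Euler product is multipliable on `Re s > 1`, continuous and non-zero at every point of `Re s > 1`
(`continuousAt_and_ne_zero_partialPairL_repData`), has a simple pole with non-zero residue at `s = 1` in the
`X`-case `β₁ = β₂⁻¹` a.e. ((2.3), hypothesis) and a finite non-zero limit otherwise ((2.2), hypothesis).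
[cite: ArthurClozelAMS120, Ch. 3 §2 (2.1)–(2.3)] [cite: JacquetShalikaAJM1981II, Prop. 3.6 and Thm. 4.4] -/
theorem stub_pairPackage :
    ∀ (F : Type) [Field F] [NumberField F] (n : ℕ) [NeZero n]
      (hF : Literature.NumberTheory.Automorphic.isCompact_glFiniteIntegralLevel n F),
      Literature.NumberTheory.Automorphic.JacquetShalika1981_partialPairL_boundary_repData →
      Literature.NumberTheory.Automorphic.JacquetShalika1981_partialPairL_pole_repData →
      ∀ (P₁ P₂ : Literature.NumberTheory.Automorphic.CuspidalAutomorphicRepData n F hF)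
        (β₁ β₂ : Literature.NumberTheory.Automorphic.SatakeFamily F),
        (∀ᶠ w : IsDedekindDomain.HeightOneSpectrum (NumberField.RingOfIntegers F) in Filter.cofinite,
          P₁.1.HasSatakeParamAt w (β₁ w)) →
        (∀ᶠ w : IsDedekindDomain.HeightOneSpectrum (NumberField.RingOfIntegers F) in Filter.cofinite,
          P₂.1.HasSatakeParamAt w (β₂ w)) →
        (∀ᶠ w : IsDedekindDomain.HeightOneSpectrum (NumberField.RingOfIntegers F) in Filter.cofinite,
          ‖(β₁ w).prod‖ = 1) →
        (∀ᶠ w : IsDedekindDomain.HeightOneSpectrum (NumberField.RingOfIntegers F) in Filter.cofinite,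
          ‖(β₂ w).prod‖ = 1) →
        ∃ S₀ : Set (IsDedekindDomain.HeightOneSpectrum (NumberField.RingOfIntegers F)), S₀.Finite ∧
          ∀ (S : Set (IsDedekindDomain.HeightOneSpectrum (NumberField.RingOfIntegers F))),
            S.Finite → S₀ ⊆ S →
            (∀ s : ℂ, 1 < s.re → Multipliable fun v :
                {v : IsDedekindDomain.HeightOneSpectrum (NumberField.RingOfIntegers F) // v ∉ S} =>
              ((Literature.NumberTheory.Automorphic.satakePairPolynomial (β₁ v.1) (β₂ v.1)).eval
                ((v.1.residueCard : ℂ) ^ (-s)))⁻¹) ∧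
            (∀ s : ℂ, 1 < s.re →
              ContinuousAt (Literature.NumberTheory.Automorphic.partialPairL S β₁ β₂) s ∧
                Literature.NumberTheory.Automorphic.partialPairL S β₁ β₂ s ≠ 0) ∧
            ((∀ᶠ w : IsDedekindDomain.HeightOneSpectrum (NumberField.RingOfIntegers F) in Filter.cofinite,
                β₁ w = (β₂ w).map (·⁻¹)) →
              ∃ c : ℂ, c ≠ 0 ∧ Filter.Tendsto
                (fun s : ℂ => (s - 1) * Literature.NumberTheory.Automorphic.partialPairL S β₁ β₂ s)
                (nhdsWithin 1 {s : ℂ | 1 < s.re}) (nhds c)) ∧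
            ((¬ ∀ᶠ w : IsDedekindDomain.HeightOneSpectrum (NumberField.RingOfIntegers F) in Filter.cofinite,
                β₁ w = (β₂ w).map (·⁻¹)) →
              ∃ c : ℂ, c ≠ 0 ∧ Filter.Tendsto (Literature.NumberTheory.Automorphic.partialPairL S β₁ β₂)
                (nhdsWithin 1 {s : ℂ | 1 < s.re}) (nhds c)) := by
  sorry

/-- **HELPER-STUB H2 — the analytic package of `L^S(s, u)` for a Hecke character unitary a.e.** (`GL₁ × GL₁`,
all THEOREMS of the tree: (2.1), `continuousAt_and_ne_zero_partialPairL_repData`, Hecke's pole of `ζ_F^S`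
when `u(ϖ_w) = 1` a.e., `JacquetShalika1981_partialPairL_boundary_repData_one_one` otherwise).
[cite: ArthurClozelAMS120, Ch. 3 §2 (2.1)–(2.3)] [cite: NeukirchANT1999, Ch. VII Cor. (5.11) (ii)] -/
theorem stub_glOnePackage :
    ∀ (F : Type) [Field F] [NumberField F]
      (u : Literature.NumberTheory.GaloisRepresentations.HeckeCharacter F),
      (∀ᶠ w : IsDedekindDomain.HeightOneSpectrum (NumberField.RingOfIntegers F) in Filter.cofinite,
        ‖u.valueAtUniformizer w‖ = 1) →
      ∃ S₀ : Set (IsDedekindDomain.HeightOneSpectrum (NumberField.RingOfIntegers F)), S₀.Finite ∧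
        ∀ (S : Set (IsDedekindDomain.HeightOneSpectrum (NumberField.RingOfIntegers F))),
          S.Finite → S₀ ⊆ S →
          (∀ s : ℂ, 1 < s.re → Multipliable fun v :
              {v : IsDedekindDomain.HeightOneSpectrum (NumberField.RingOfIntegers F) // v ∉ S} =>
            ((Literature.NumberTheory.Automorphic.satakePairPolynomial {u.valueAtUniformizer v.1} {1}).eval
              ((v.1.residueCard : ℂ) ^ (-s)))⁻¹) ∧
          (∀ s : ℂ, 1 < s.re →
            ContinuousAt (Literature.NumberTheory.Automorphic.partialPairL S
              (fun w => {u.valueAtUniformizer w}) (fun _ => {1})) s ∧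
              Literature.NumberTheory.Automorphic.partialPairL S
                (fun w => {u.valueAtUniformizer w}) (fun _ => {1}) s ≠ 0) ∧
          ((∀ᶠ w : IsDedekindDomain.HeightOneSpectrum (NumberField.RingOfIntegers F) in Filter.cofinite,
              u.valueAtUniformizer w = 1) →
            ∃ c : ℂ, c ≠ 0 ∧ Filter.Tendsto
              (fun s : ℂ => (s - 1) * Literature.NumberTheory.Automorphic.partialPairL S
                (fun w => {u.valueAtUniformizer w}) (fun _ => {1}) s)
              (nhdsWithin 1 {s : ℂ | 1 < s.re}) (nhds c)) ∧
          ((¬ ∀ᶠ w : IsDedekindDomain.HeightOneSpectrum (NumberField.RingOfIntegers F) in Filter.cofinite,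
              u.valueAtUniformizer w = 1) →
            ∃ c : ℂ, c ≠ 0 ∧ Filter.Tendsto
              (Literature.NumberTheory.Automorphic.partialPairL S
                (fun w => {u.valueAtUniformizer w}) (fun _ => {1}))
              (nhdsWithin 1 {s : ℂ | 1 < s.re}) (nhds c)) := by
  sorry

/-- **HELPER-STUB H3 — the 46-term Euler-factor identity of the (2,2) case** (card
`dual-pair-rankin-selberg-syzygy`, `λ·V = λ·W`): for the Satake multiset `t = {a, b, c, d}` split as
`{a, b} ⊔ {c, d}` with `χ = ab`, `λ = cd/(ab)`, the products of Rankin–Selberg polynomials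
`P(t, t⁻¹λ) P(t, t⁻¹λ²) P(∧²t, χ⁻¹λ)² P(1, 1) P(λ³, 1)` and
`P(t, t·χ⁻¹λ) P(t⁻¹, t⁻¹·χλ²) P(∧²t, χ⁻¹) P(∧²t, χ⁻¹λ²) P(λ, 1) P(λ², 1)` coincide (both are the Euler
polynomial of one 46-element multiset; machine-checked on 300 random rational instances).
[cite: Shavali2026GL4, Prop. 4.2] -/
theorem stub_twoTwoIdentity :
    ∀ (a b c d : ℂ), a ≠ 0 → b ≠ 0 → c ≠ 0 → d ≠ 0 →
      Literature.NumberTheory.Automorphic.satakePairPolynomial {a, b, c, d}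
          ((({a, b, c, d} : Multiset ℂ).map (·⁻¹)).map (c * d * (a * b)⁻¹ * ·)) *
        Literature.NumberTheory.Automorphic.satakePairPolynomial {a, b, c, d}
          ((({a, b, c, d} : Multiset ℂ).map (·⁻¹)).map ((c * d * (a * b)⁻¹) ^ 2 * ·)) *
        Literature.NumberTheory.Automorphic.satakePairPolynomial
          (Literature.NumberTheory.Automorphic.wedgeTwoParams {a, b, c, d})
          {(a * b)⁻¹ * (c * d * (a * b)⁻¹)} *
        Literature.NumberTheory.Automorphic.satakePairPolynomial
          (Literature.NumberTheory.Automorphic.wedgeTwoParams {a, b, c, d})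
          {(a * b)⁻¹ * (c * d * (a * b)⁻¹)} *
        Literature.NumberTheory.Automorphic.satakePairPolynomial {1} {1} *
        Literature.NumberTheory.Automorphic.satakePairPolynomial {(c * d * (a * b)⁻¹) ^ 3} {1} =
      Literature.NumberTheory.Automorphic.satakePairPolynomial {a, b, c, d}
          (({a, b, c, d} : Multiset ℂ).map ((a * b)⁻¹ * (c * d * (a * b)⁻¹) * ·)) *
        Literature.NumberTheory.Automorphic.satakePairPolynomial (({a, b, c, d} : Multiset ℂ).map (·⁻¹))
          ((({a, b, c, d} : Multiset ℂ).map (·⁻¹)).map (a * b * (c * d * (a * b)⁻¹) ^ 2 * ·)) *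
        Literature.NumberTheory.Automorphic.satakePairPolynomial
          (Literature.NumberTheory.Automorphic.wedgeTwoParams {a, b, c, d}) {(a * b)⁻¹} *
        Literature.NumberTheory.Automorphic.satakePairPolynomial
          (Literature.NumberTheory.Automorphic.wedgeTwoParams {a, b, c, d})
          {(a * b)⁻¹ * (c * d * (a * b)⁻¹) ^ 2} *
        Literature.NumberTheory.Automorphic.satakePairPolynomial {c * d * (a * b)⁻¹} {1} *
        Literature.NumberTheory.Automorphic.satakePairPolynomial {(c * d * (a * b)⁻¹) ^ 2} {1} := by
  sorry

/-! ### The three named facts of the tree the line rests on, declared as stubs (they are NOT to be proved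
inside this crux: each is an existing Literature `def … : Prop` with its own discharge programme; the final
theorem is CONDITIONAL on exactly these) -/

/-- **FACT-STUB — Jacquet–Shalika (Arthur–Clozel Ch. 3 (2.2)) for Borel–Jacquet data** = route item
`PairLBoundaryJS` (stmt-Langlands-13622), definitionally the tree's named fact
`Literature.NumberTheory.Automorphic.JacquetShalika1981_partialPairL_boundary_repData` (finite non-zero
boundary values of `L^S(s, π × σ)` on `Re s = 1` off `X`). Consumed by `stub_noLineAnalytic`,
`stub_noPlanesAnalytic`. [cite: JacquetShalikaAJM1981II, Prop. 3.6 and Thm. 4.4]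
[cite: ArthurClozelAMS120, Ch. 3 §2 (2.2)] -/
theorem stub_factJS22 :
    Summit.Langlands.Langlands.Theses.ExteriorSquareAscent.PairLBoundaryJS := by
  sorry

/-- **FACT-STUB — Jacquet–Shalika (Arthur–Clozel Ch. 3 (2.3)) for Borel–Jacquet data** = route item `PairLPoleJS`
(stmt-Langlands-19093), definitionally the tree's named fact
`Literature.NumberTheory.Automorphic.JacquetShalika1981_partialPairL_pole_repData` (the simple pole of
`L^S(s, π × σ)` at `s₀ ∈ X`). Consumed by `stub_noPlanesAnalytic` (pole of `L^S(s, π × π^∨)`).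
[cite: JacquetShalikaAJM1981II, Prop. 3.6 and Thm. 4.4] [cite: ArthurClozelAMS120, Ch. 3 §2 (2.3)] -/
theorem stub_factJS23 :
    Summit.Langlands.Langlands.Theses.ExteriorSquareAscent.PairLPoleJS := by
  sorry

/-- **FACT-STUB — Asgari–Raghuram 2007, Thm. 1 (i)⇒(iii), Satake form** = route item `WedgeTwoNotCuspidalAR`
(stmt-Langlands-18128, the GL(1)-datum form = `AsgariRaghuram2007_notCuspidal_wedgeTwo_imp` definitionally; its
Hecke-character form `AsgariRaghuram2007_selfDual_or_selfTwist_of_wedgeTwo_not_cuspidal` used by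
`stub_wedgeTwoCuspidal` follows by `…_of_notCuspidal_wedgeTwo_imp`). Consumed by `stub_wedgeTwoCuspidal`. [cite: AsgariRaghuram2007, Theorem 1 (i) ⇒ (iii)] -/
theorem stub_factAR :
    Summit.Langlands.Langlands.Theses.ExteriorSquareAscent.WedgeTwoNotCuspidalAR := by
  sorry

/-! ## 2. The stub statements as named `Prop`s (literally their types) -/

namespace _Goal

/-- The statement of `stub_lineHecke`, as a named `Prop`. [folklore] -/
def stub_lineHecke : Prop :=
  type_of% @Summit.Langlands.Langlands.Cruxes.ReducibleInducesSquare.Sketch.stub_lineHecke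

/-- The statement of `stub_planesBlocks`, as a named `Prop`. [folklore] -/
def stub_planesBlocks : Prop :=
  type_of% @Summit.Langlands.Langlands.Cruxes.ReducibleInducesSquare.Sketch.stub_planesBlocks

/-- The statement of `stub_planesAmbient`, as a named `Prop`. [folklore] -/
def stub_planesAmbient : Prop :=
  type_of% @Summit.Langlands.Langlands.Cruxes.ReducibleInducesSquare.Sketch.stub_planesAmbient

/-- The statement of `stub_planesHecke`, as a named `Prop`. [folklore] -/
def stub_planesHecke : Prop :=
  type_of% @Summit.Langlands.Langlands.Cruxes.ReducibleInducesSquare.Sketch.stub_planesHecke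

/-- The statement of `stub_wedgeTwoCuspidal`, as a named `Prop`. [folklore] -/
def stub_wedgeTwoCuspidal : Prop :=
  type_of% @Summit.Langlands.Langlands.Cruxes.ReducibleInducesSquare.Sketch.stub_wedgeTwoCuspidal

/-- The statement of `stub_noLineAnalytic`, as a named `Prop`. [folklore] -/
def stub_noLineAnalytic : Prop :=
  type_of% @Summit.Langlands.Langlands.Cruxes.ReducibleInducesSquare.Sketch.stub_noLineAnalytic

/-- The statement of `stub_noPlanesAnalytic`, as a named `Prop`. [folklore] -/
def stub_noPlanesAnalytic : Prop :=
  type_of% @Summit.Langlands.Langlands.Cruxes.ReducibleInducesSquare.Sketch.stub_noPlanesAnalytic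

/-- The statement of `stub_pairPackage`, as a named `Prop`. [folklore] -/
def stub_pairPackage : Prop :=
  type_of% @Summit.Langlands.Langlands.Cruxes.ReducibleInducesSquare.Sketch.stub_pairPackage

/-- The statement of `stub_glOnePackage`, as a named `Prop`. [folklore] -/
def stub_glOnePackage : Prop :=
  type_of% @Summit.Langlands.Langlands.Cruxes.ReducibleInducesSquare.Sketch.stub_glOnePackage

/-- The statement of `stub_twoTwoIdentity`, as a named `Prop`. [folklore] -/
def stub_twoTwoIdentity : Prop :=
  type_of% @Summit.Langlands.Langlands.Cruxes.ReducibleInducesSquare.Sketch.stub_twoTwoIdentity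

/-- The statement of `stub_factJS22`, as a named `Prop` (the named fact itself). [folklore] -/
def stub_factJS22 : Prop :=
  type_of% @Summit.Langlands.Langlands.Cruxes.ReducibleInducesSquare.Sketch.stub_factJS22

/-- The statement of `stub_factJS23`, as a named `Prop` (the named fact itself). [folklore] -/
def stub_factJS23 : Prop :=
  type_of% @Summit.Langlands.Langlands.Cruxes.ReducibleInducesSquare.Sketch.stub_factJS23

/-- The statement of `stub_factAR`, as a named `Prop` (the named fact itself). [folklore] -/
def stub_factAR : Prop :=
  type_of% @Summit.Langlands.Langlands.Cruxes.ReducibleInducesSquare.Sketch.stub_factAR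

end _Goal

/-! ## 3. Proved here: `E`-rationality from the Hecke field (BH §3.1 for `n = 4`) -/

section Rational

variable {K : Type} [Field K] [NumberField K] {hcpt : isCompact_glFiniteIntegralLevel 4 K}
  {ℓ : ℕ} [Fact ℓ.Prime]

/-- `e₁{a, b, c, d}`. [folklore] -/
theorem esymm_one_quad (a b c d : ℂ) : ({a, b, c, d} : Multiset ℂ).esymm 1 = a + b + c + d := by
  simp [Multiset.esymm, Multiset.powersetCard_one, Multiset.insert_eq_cons]
  ring

/-- `e₂{a, b, c, d}`. [folklore] -/
theorem esymm_two_quad (a b c d : ℂ) :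
    ({a, b, c, d} : Multiset ℂ).esymm 2 = a * b + a * c + a * d + b * c + b * d + c * d := by
  simp [Multiset.esymm, Multiset.powersetCard_one, Multiset.insert_eq_cons, Multiset.powersetCard_cons]
  ring

/-- `e₃{a, b, c, d}`. [folklore] -/
theorem esymm_three_quad (a b c d : ℂ) :
    ({a, b, c, d} : Multiset ℂ).esymm 3 = a * b * c + a * b * d + a * c * d + b * c * d := by
  simp [Multiset.esymm, Multiset.powersetCard_one, Multiset.insert_eq_cons, Multiset.powersetCard_cons]
  ring

/-- `e₄{a, b, c, d}`. [folklore] -/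
theorem esymm_four_quad (a b c d : ℂ) : ({a, b, c, d} : Multiset ℂ).esymm 4 = a * b * c * d := by
  simp [Multiset.esymm, Multiset.powersetCard_one, Multiset.insert_eq_cons, Multiset.powersetCard_cons]
  ring

/-- A multiset of cardinality four is `{a, b, c, d}`. [folklore] -/
theorem exists_eq_quad_of_card_eq_four {α : Multiset ℂ} (h : Multiset.card α = 4) :
    ∃ a b c d : ℂ, α = {a, b, c, d} := by
  obtain ⟨a, ha⟩ : ∃ a, a ∈ α := Multiset.card_pos_iff_exists_mem.1 (by omega)
  obtain ⟨β, rfl⟩ := Multiset.exists_cons_of_mem ha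
  have hβ : Multiset.card β = 3 := by
    rw [Multiset.card_cons] at h
    omega
  obtain ⟨b, c, d, rfl⟩ := Multiset.card_eq_three.1 hβ
  exact ⟨a, b, c, d, rfl⟩

/-- **`E`-rationality of an a.e.-compatible rank-four `ρ` from the Hecke field of `π` (BH §3.1, `n = 4`).**
If the C-normalised Hecke coefficients `q_v^{i(4-i)/2} e_i(t_{π,v})` lie in the subfield `E ⊆ ℂ` for almost
all `v` (the crux's Hecke-field hypothesis) and `ρ` is a.e. Satake–Frobenius compatible with `(π, ι)`
(`arithFrobPolyOfSatake ι q_v 4`: roots `ι⁻¹((q_v^{3/2} a)⁻¹)`), then `ρ` is `E`-rational for `ι⁻¹|_E`: with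
`t_{π,v} = {a, b, c, d}` (non-zero) the Frobenius polynomial is
`X⁴ - ι⁻¹(q^{3/2}e₃/(q⁶e₄)) X³ + ι⁻¹(q²e₂/(q⁷e₄)) X² - ι⁻¹(q^{3/2}e₁/(q⁹ e₄)) X + ι⁻¹(1/(q⁶e₄))`, whose
coefficients lie in `ι⁻¹(E)` because `q^{3/2}e₁, q²e₂, q^{3/2}e₃, e₄, q ∈ E`. [cite: BockleHui2025, §3.1] -/
theorem isRationalOver_of_heckeField
    (π : AutomorphicRepData (AutomorphyDatum.gl 4 K hcpt)) (ι : PadicAlgCl ℓ ≃+* ℂ)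
    (ρ : FramedGaloisRep K (PadicAlgCl ℓ) 4) (E : Subfield ℂ)
    (hE : ∀ᶠ v : HeightOneSpectrum (𝓞 K) in cofinite, ∀ α : Multiset ℂ, π.HasSatakeParamAt v α →
      ∀ i ≤ 4, ((((Real.sqrt (v.residueCard : ℝ)) : ℝ) : ℂ) ^ (i * (4 - i))) * α.esymm i ∈ E)
    (hcomp : ∀ᶠ v : HeightOneSpectrum (𝓞 K) in cofinite, ∃ α : Multiset ℂ, π.HasSatakeParamAt v α ∧
      ρ.IsUnramifiedAt v ∧ ρ.HasFrobCharpolyAt v (arithFrobPolyOfSatake ι v.residueCard 4 α)) :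
    ρ.IsRationalOver ((ι.symm : ℂ ≃+* PadicAlgCl ℓ).toRingHom.comp E.subtype) := by
  filter_upwards [hE, hcomp] with v hEv hv
  obtain ⟨α, hα, hunr, hP⟩ := hv
  refine ⟨hunr, ?_⟩
  have hne : ∀ a ∈ α, a ≠ 0 := hasSatakeParamAt_ne_zero_holds hα
  have ht1 := hEv _ hα 1 (by norm_num)
  have ht2 := hEv _ hα 2 (by norm_num)
  have ht3 := hEv _ hα 3 (by norm_num)
  have ht4 := hEv _ hα 4 le_rfl
  obtain ⟨a, b, c, d, rfl⟩ := exists_eq_quad_of_card_eq_four hα.card_eq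
  have ha : a ≠ 0 := hne a (by simp)
  have hb : b ≠ 0 := hne b (by simp)
  have hc : c ≠ 0 := hne c (by simp)
  have hd : d ≠ 0 := hne d (by simp)
  rw [esymm_one_quad] at ht1
  rw [esymm_two_quad] at ht2
  rw [esymm_three_quad] at ht3
  rw [esymm_four_quad] at ht4
  norm_num at ht1 ht2 ht3 ht4
  -- `√q`
  set q : ℕ := v.residueCard with hq
  set sq : ℂ := ((Real.sqrt (q : ℝ) : ℝ) : ℂ) with hsq
  have hsq2 : sq ^ 2 = (q : ℂ) := by
    rw [hsq, ← Complex.ofReal_pow, Real.sq_sqrt (Nat.cast_nonneg _), Complex.ofReal_natCast]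
  have hsq0 : sq ≠ 0 := by
    rw [hsq, Complex.ofReal_ne_zero]
    exact Real.sqrt_ne_zero'.2 (by exact_mod_cast lt_trans zero_lt_one v.one_lt_residueCard)
  have hqE : sq ^ 2 ∈ E := by rw [hsq2]; exact natCast_mem E q
  have he4 : a * b * c * d ∈ E := by simpa using ht4
  have habcd : a * b * c * d ≠ 0 := mul_ne_zero (mul_ne_zero (mul_ne_zero ha hb) hc) hd
  -- the inverse roots `(q^{3/2} x)⁻¹` and their symmetric functions
  set u : ℂ := (sq ^ 3 * a)⁻¹ with hu
  set w : ℂ := (sq ^ 3 * b)⁻¹ with hw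
  set z : ℂ := (sq ^ 3 * c)⁻¹ with hz
  set y : ℂ := (sq ^ 3 * d)⁻¹ with hy
  have hS1 : u + w + z + y ∈ E := by
    have e : u + w + z + y =
        (sq ^ 3 * (a * b * c + a * b * d + a * c * d + b * c * d)) *
          (sq ^ 2 * sq ^ 2 * sq ^ 2 * (a * b * c * d))⁻¹ := by
      rw [hu, hw, hz, hy]
      field_simp
      ring
    rw [e]
    exact mul_mem ht3 (inv_mem (mul_mem (mul_mem (mul_mem hqE hqE) hqE) he4))
  have hS2 : u * w + u * z + u * y + w * z + w * y + z * y ∈ E := by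
    have e : u * w + u * z + u * y + w * z + w * y + z * y =
        (sq ^ 4 * (a * b + a * c + a * d + b * c + b * d + c * d)) *
          (sq ^ 2 * sq ^ 2 * sq ^ 2 * sq ^ 2 * sq ^ 2 * (a * b * c * d))⁻¹ := by
      rw [hu, hw, hz, hy]
      field_simp
      ring
    rw [e]
    exact mul_mem ht2
      (inv_mem (mul_mem (mul_mem (mul_mem (mul_mem (mul_mem hqE hqE) hqE) hqE) hqE) he4))
  have hS3 : u * w * z + u * w * y + u * z * y + w * z * y ∈ E := by
    have e : u * w * z + u * w * y + u * z * y + w * z * y =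
        (sq ^ 3 * (a + b + c + d)) *
          (sq ^ 2 * sq ^ 2 * sq ^ 2 * sq ^ 2 * sq ^ 2 * sq ^ 2 * (a * b * c * d))⁻¹ := by
      rw [hu, hw, hz, hy]
      field_simp
      ring
    rw [e]
    exact mul_mem ht1
      (inv_mem (mul_mem (mul_mem (mul_mem (mul_mem (mul_mem (mul_mem hqE hqE) hqE) hqE) hqE) hqE) he4))
  have hS4 : u * w * z * y ∈ E := by
    have e : u * w * z * y =
        (sq ^ 2 * sq ^ 2 * sq ^ 2 * sq ^ 2 * sq ^ 2 * sq ^ 2 * (a * b * c * d))⁻¹ := by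
      rw [hu, hw, hz, hy]
      field_simp
    rw [e]
    exact inv_mem (mul_mem (mul_mem (mul_mem (mul_mem (mul_mem (mul_mem hqE hqE) hqE) hqE) hqE) hqE) he4)
  refine ⟨X ^ 4 - C (⟨u + w + z + y, hS1⟩ : E) * X ^ 3 +
    C (⟨u * w + u * z + u * y + w * z + w * y + z * y, hS2⟩ : E) * X ^ 2 -
    C (⟨u * w * z + u * w * y + u * z * y + w * z * y, hS3⟩ : E) * X +
    C (⟨u * w * z * y, hS4⟩ : E), ?_⟩
  intro 𝔓 h𝔓 σ hσ
  rw [hP 𝔓 h𝔓 σ hσ]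
  simp only [arithFrobPolyOfSatake, Multiset.insert_eq_cons, Multiset.map_cons,
    Multiset.map_singleton, Multiset.prod_cons, Multiset.prod_singleton, Polynomial.map_add,
    Polynomial.map_sub, Polynomial.map_mul, Polynomial.map_pow, map_X, map_C,
    RingHom.coe_comp, Function.comp_apply, RingEquiv.toRingHom_eq_coe, RingEquiv.coe_toRingHom,
    Subfield.coe_subtype, map_add, map_mul]
  have h41 : (4 - 1 : ℕ) = 3 := rfl
  rw [h41, ← hsq, ← hu, ← hw, ← hz, ← hy]
  ring

/-- The `∃`-form consumed by the stubs: a compatible `ρ` of a `π` with a Hecke field is `E`-rational for some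
number field `E`. [cite: BockleHui2025, §3.1] -/
theorem exists_isRationalOver_of_heckeField
    (π : AutomorphicRepData (AutomorphyDatum.gl 4 K hcpt)) (ι : PadicAlgCl ℓ ≃+* ℂ)
    (ρ : FramedGaloisRep K (PadicAlgCl ℓ) 4)
    (hE : ∃ E : Subfield ℂ, FiniteDimensional ℚ E ∧ ∀ᶠ v : HeightOneSpectrum (𝓞 K) in cofinite,
      ∀ α : Multiset ℂ, π.HasSatakeParamAt v α →
        ∀ i ≤ 4, ((((Real.sqrt (v.residueCard : ℝ)) : ℝ) : ℂ) ^ (i * (4 - i))) * α.esymm i ∈ E)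
    (hcomp : ∀ᶠ v : HeightOneSpectrum (𝓞 K) in cofinite, ∃ α : Multiset ℂ, π.HasSatakeParamAt v α ∧
      ρ.IsUnramifiedAt v ∧ ρ.HasFrobCharpolyAt v (arithFrobPolyOfSatake ι v.residueCard 4 α)) :
    ∃ (E : Type) (_ : Field E) (_ : NumberField E) (e : E →+* PadicAlgCl ℓ), ρ.IsRationalOver e := by
  obtain ⟨E, hfd, hE⟩ := hE
  haveI : FiniteDimensional ℚ E := hfd
  haveI : NumberField E := NumberField.mk
  exact ⟨E, inferInstance, inferInstance, _, isRationalOver_of_heckeField π ι ρ E hE hcomp⟩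

end Rational

/-! ## 4. Proved here: the case split `3 + 1` / `2 + 2` (from line `birth`) -/

/-- **A reducible semisimple representation of dimension 4 with no stable line is `2 + 2`.** [folklore] -/
theorem twoPlusTwo_of_not_isIrreducible {k G V : Type*} [Field k] [Monoid G] [AddCommGroup V]
    [Module k V] [FiniteDimensional k V] (ρ : Representation k G V) (h4 : Module.finrank k V = 4)
    (hss : ρ.IsSemisimpleRepresentation) (hirr : ¬ ρ.IsIrreducible)
    (hno1 : ∀ W : Subrepresentation ρ, Module.finrank k W.toSubmodule ≠ 1) :
    ∃ W₁ W₂ : Subrepresentation ρ, IsCompl W₁ W₂ ∧ Module.finrank k W₁.toSubmodule = 2 ∧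
      Module.finrank k W₂.toSubmodule = 2 := by
  classical
  have hbot : (⊥ : Subrepresentation ρ).toSubmodule = ⊥ := rfl
  have htop : (⊤ : Subrepresentation ρ).toSubmodule = ⊤ := rfl
  have hV : Nontrivial V := Module.nontrivial_of_finrank_pos (R := k) (by omega)
  have hnt : (⊥ : Subrepresentation ρ) ≠ ⊤ := by
    intro h
    have h' := congrArg Subrepresentation.toSubmodule h
    rw [hbot, htop] at h'
    exact bot_ne_top h'
  obtain ⟨W, hWb, hWt⟩ : ∃ W : Subrepresentation ρ, W ≠ ⊥ ∧ W ≠ ⊤ := by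
    by_contra h
    push Not at h
    apply hirr
    haveI : Nontrivial (Subrepresentation ρ) := ⟨⟨⊥, ⊤, hnt⟩⟩
    exact ⟨fun W => (Classical.em (W = ⊥)).imp_right (h W)⟩
  haveI := hss
  obtain ⟨W', hWW'⟩ := exists_isCompl W
  have hWb' : W.toSubmodule ≠ ⊥ := fun h =>
    hWb (Subrepresentation.toSubmodule_injective (h.trans hbot.symm))
  have hWt' : W.toSubmodule ≠ ⊤ := fun h =>
    hWt (Subrepresentation.toSubmodule_injective (h.trans htop.symm))
  have hinf : W.toSubmodule ⊓ W'.toSubmodule = ⊥ := by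
    have := hWW'.disjoint
    rw [disjoint_iff] at this
    exact (congrArg Subrepresentation.toSubmodule this).trans hbot
  have hsup : W.toSubmodule ⊔ W'.toSubmodule = ⊤ := by
    have := hWW'.codisjoint
    rw [codisjoint_iff] at this
    exact (congrArg Subrepresentation.toSubmodule this).trans htop
  have hsum : Module.finrank k W.toSubmodule + Module.finrank k W'.toSubmodule = 4 := by
    have := Submodule.finrank_sup_add_finrank_inf_eq W.toSubmodule W'.toSubmodule
    rw [hinf, hsup, finrank_top, finrank_bot, h4] at this
    omega
  have hpos : 0 < Module.finrank k W.toSubmodule := by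
    rw [pos_iff_ne_zero, Ne, Submodule.finrank_eq_zero]
    exact hWb'
  have hlt : Module.finrank k W.toSubmodule < 4 := by
    rw [← h4]
    exact Submodule.finrank_lt hWt'
  have h1 := hno1 W
  have h1' := hno1 W'
  exact ⟨W, W', hWW', by omega, by omega⟩

/-- The framed Galois case: a reducible semisimple `ρ : Γ_K → GL₄(ℚ̄_ℓ)` with no stable line has two
complementary stable planes. [folklore] -/
theorem twoPlusTwo_of_reducible {K : Type} [Field K] {ℓ : ℕ} [Fact ℓ.Prime]
    (ρ : FramedGaloisRep K (PadicAlgCl ℓ) 4) (hss : ρ.toGaloisRep.IsSemisimple)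
    (hirr : ¬ ρ.toGaloisRep.IsIrreducible)
    (hno1 : ∀ W : Subrepresentation ρ.toGaloisRep.toRepresentation,
      Module.finrank (PadicAlgCl ℓ) W.toSubmodule ≠ 1) :
    ∃ W₁ W₂ : Subrepresentation ρ.toGaloisRep.toRepresentation, IsCompl W₁ W₂ ∧
      Module.finrank (PadicAlgCl ℓ) W₁.toSubmodule = 2 ∧ Module.finrank (PadicAlgCl ℓ) W₂.toSubmodule = 2 :=
  twoPlusTwo_of_not_isIrreducible ρ.toGaloisRep.toRepresentation (Module.finrank_fin_fun (PadicAlgCl ℓ))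
    hss hirr hno1

/-! ## 5. The composition (kernel-checked, no `sorry`) -/

/-- **`ReducibleInducesSquare` from the seven stubs, granting Jacquet–Shalika (2.2)/(2.3) for Borel–Jacquet
data and Asgari–Raghuram (i)⇒(iii).** Fix `K, π, ℓ, ι, ρ` as in the crux with `ρ` reducible. STUB E gives the
cuspidal `Π` on `GL₆`. If `ρ` has a stable line, STUBS A and F contradict each other; otherwise
`twoPlusTwo_of_reducible` splits `ρ = W₁ ⊕ W₂` into stable planes, STUBS B, C, D produce the pair-product
Hecke character, and STUB G (with `¬` ess-self-dual moved from `GL(1)` data to Hecke characters by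
`exists_cuspidal_glOne_hasSatakeParamAt_valueAtUniformizer`) is contradicted. Either way `False`, whence the
conclusion. The `E`-rationality input of STUBS A and D is `exists_isRationalOver_of_heckeField`.
[cite: Shavali2026, Props. 4.1–4.2] -/
theorem ReducibleInducesSquare_of
    (hJ22 : _Goal.stub_factJS22) (hJ23 : _Goal.stub_factJS23) (hAR : _Goal.stub_factAR)
    (hA : _Goal.stub_lineHecke) (hB : _Goal.stub_planesBlocks) (hC : _Goal.stub_planesAmbient)
    (hD : _Goal.stub_planesHecke) (hW : _Goal.stub_wedgeTwoCuspidal)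
    (hE : _Goal.stub_noLineAnalytic) (hF : _Goal.stub_noPlanesAnalytic)
    (hH1 : _Goal.stub_pairPackage) (hH2 : _Goal.stub_glOnePackage) (hH3 : _Goal.stub_twoTwoIdentity) :
    Summit.Langlands.Langlands.Theses.ExteriorSquareAscent.ReducibleInducesSquare := by
  have hJ22' : type_of% @stub_factJS22 := hJ22
  have hJ23' : type_of% @stub_factJS23 := hJ23
  have hAR' : type_of% @stub_factAR := hAR
  have hA' : type_of% @stub_lineHecke := hA
  have hB' : type_of% @stub_planesBlocks := hB
  have hC' : type_of% @stub_planesAmbient := hC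
  have hD' : type_of% @stub_planesHecke := hD
  have hW' : type_of% @stub_wedgeTwoCuspidal := hW
  have hE' : type_of% @stub_noLineAnalytic := hE
  have hF' : type_of% @stub_noPlanesAnalytic := hF
  intro K _ _ h1 hcpt π hHF hNE hST ℓ _ ι ρ hss hcomp hirr
  exfalso
  have h6 : isCompact_glFiniteIntegralLevel 6 K := isCompact_glFiniteIntegralLevel_holds 6 K
  -- the cuspidal exterior square
  have hARh : Literature.NumberTheory.Automorphic.AsgariRaghuram2007_selfDual_or_selfTwist_of_wedgeTwo_not_cuspidal :=
    AsgariRaghuram2007_selfDual_or_selfTwist_of_wedgeTwo_not_cuspidal_of_notCuspidal_wedgeTwo_imp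
      fun F _ _ h1' h4' h6' π' hno => hAR' F h1' h4' h6' π' hno
  obtain ⟨P6, hP6⟩ := hW' K h1 hcpt h6 π hARh hNE hST
  -- `E`-rationality of `ρ`
  have hrat : ∃ (E : Type) (_ : Field E) (_ : NumberField E) (e : E →+* PadicAlgCl ℓ),
      ρ.IsRationalOver e :=
    exists_isRationalOver_of_heckeField π.1 ι ρ hHF hcomp
  by_cases hline : ∃ W : Subrepresentation ρ.toGaloisRep.toRepresentation,
      Module.finrank (PadicAlgCl ℓ) W.toSubmodule = 1
  · -- (3,1): a stable line gives a Hecke character among the Satake eigenvalues — impossible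
    obtain ⟨W, hW1⟩ := hline
    obtain ⟨μ, hμ⟩ := hA' K hcpt π ℓ ι ρ hss hcomp hrat W hW1
    exact hE' K hcpt h6 π P6 hJ22' hP6 μ hμ
  · -- (2,2): two complementary stable planes give a pair-product Hecke character — impossible
    push Not at hline
    obtain ⟨W₁, W₂, hc, hW₁, hW₂⟩ := twoPlusTwo_of_reducible ρ hss hirr hline
    obtain ⟨S, T, hprod, hker⟩ := hB' K ℓ ρ W₁ W₂ hc hW₁ hW₂
    have hunr : ∀ᶠ v : HeightOneSpectrum (𝓞 K) in cofinite, ρ.IsUnramifiedAt v :=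
      hcomp.mono fun v hv => hv.choose_spec.2.1
    obtain ⟨ψ, ρ', hψ, hwd, hrat'⟩ := hC' K ℓ ρ S T hprod hker hunr
    have hdvd : ∀ g : Field.absoluteGaloisGroup K, FramedRep.charpoly S g ∣ FramedRep.charpoly ρ g :=
      fun g => Dvd.intro _ (hprod g).symm
    obtain ⟨χ, hχ⟩ := hD' K hcpt π ℓ ι ρ hcomp hrat S hdvd ψ ρ' hψ hwd hrat'
    have hNE' : ¬ ∃ e : HeckeCharacter K, ∀ᶠ v : HeightOneSpectrum (𝓞 K) in cofinite,
        ∀ α : Multiset ℂ, π.1.HasSatakeParamAt v α →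
          α.map (fun a => a⁻¹) = α.map (fun a => e.valueAtUniformizer v * a) := by
      rintro ⟨e, he⟩
      obtain ⟨η, hη⟩ := exists_cuspidal_glOne_hasSatakeParamAt_valueAtUniformizer h1 e
      refine hNE ⟨η, ?_⟩
      filter_upwards [he, hη] with v hv hηv α hα
      exact ⟨_, hηv, hv α hα⟩
    exact hF' K hcpt h6 π P6 hJ22' hJ23' hP6 hNE' χ hχ

/-- By-name sanity check: the stubs feed the composition as they stand. -/
example : Summit.Langlands.Langlands.Theses.ExteriorSquareAscent.ReducibleInducesSquare :=
  ReducibleInducesSquare_of stub_factJS22 stub_factJS23 stub_factAR stub_lineHecke stub_planesBlocks stub_planesAmbient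
    stub_planesHecke stub_wedgeTwoCuspidal stub_noLineAnalytic stub_noPlanesAnalytic
    stub_pairPackage stub_glOnePackage stub_twoTwoIdentity

end Summit.Langlands.Langlands.Cruxes.ReducibleInducesSquare.Sketch

end
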